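import Summits.Ventures.HSemireg.WedgeKernelDuality
import Summits.Ventures.HSemireg.WedgeHankelConfluentRank
import Summits.Ventures.HSemireg.WedgeHankelSecantSiegel

/-!
# Venture HSemireg — THE CO-SIEGEL FORMS: `Ann(SI_k)` is the space of forms killed by every Siegel 2-vector; it is the IMAGE of every generic class, and the
# image of a node of order `P + 1` is its intersection with `Ann(xRich)` — the first image NAMES of the lineage

HONEST FRAMING. Part of the Lean index of the computation cell `pub-hsemireg` (seat p10 gen 16, Sunday typer «UNIFORM-IN-n»).
Finite-dimensional EXTERIOR ALGEBRA over a field ONLY: no variety, no cohomology theory, no sheaf, no Ext group, no semiregularity map;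
nothing here says that HC / HC_CM / HC_AV holds; no Literature fact is declared or used.  Custodian versions as in `WedgeHankelSiegelIdeal` (1/3) and
`WedgeKernelDuality`; the dictionary (`V(univ, w_n(q), k′)` ↔ the image of `⌟v` on `H^•(⋀^• T)`; the Siegel 2-vectors `s_{ab} = x_a y_b + x_b y_a`) is QUOTED, never asserted.

WHAT IS IN THE TREE.  E1 `WedgeKernelDuality` (the top-coefficient pairing is perfect; `Ann`; `Kr_w_eq_Ann`, `V_w_eq_Ann`, `Ann_Ann`, `Ann_sup`); gen 11's `siegelIdeal`
(`SI_k = span{E_t ∧ s_p}`, `finrank_siegelIdeal`, the full-rank criterion); D3 `siegelIdeal_le_Kr_w`; E3/E6 (one node: `Kr = SI_k ⊔ xRich(k,P)`, rank `min(P,k)+1`).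
Gen 14/15 asked for the NAME of the images (KERNEL-ATLAS F4; READ-NOTE-p10-g15 OPEN).  THIS FILE:
* §64 **`coSiegel n j := {θ ∈ Hom(univ, j) : θ ∧ s_p = 0 for every Siegel pair p}`** — the CO-SIEGEL forms (killed by every Siegel 2-vector).
* §65 **`Ann_siegelIdeal`: `Ann_j(SI_k) = coSiegel(j)` for `k + j = 2n`** (the Siegel 2-vectors are even, hence central; E1's non-degeneracy on monomials), and dually
  **`siegelIdeal_eq_Ann_coSiegel`: `SI_k = Ann_k(coSiegel(j))`**; `finrank_coSiegel`: `dim coSiegel(j) = (k+1)·C(n,k)`.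
* §66 **THE GENERIC IMAGE `V_w_eq_coSiegel_of_rank`: if `rank H_k(q) = k + 1` then `V(univ, w_n(q), k′) = coSiegel(n + k′)`** (`k + k′ = n`) — the image of EVERY class
  of full Hankel rank in degree `k` is the same space: the co-Siegel forms of degree `n + k′` (`Kr_w_eq_siegelIdeal_of_rank` + E1's `V_w_eq_Ann`).
* §67 **THE IMAGE OF A NODE `V_w_of_order`: `V(univ, w_n(q), k′) = coSiegel(n + k′) ⊓ Ann_{n+k′}(xRich(k, P))`** for `q` of exact order `P ≤ k′` at `0` (`k + k′ = n`), and at the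
  node `λ`: `coSiegel(n + k′) ⊓ Φs λ (Ann(xRich(k,P)))` (`map_Φs_coSiegel`: the co-Siegel space is frame-invariant; E5's `V_w_expMul`).
NOT typed here: the monomial NAME of `Ann(xRich(k, P))` (`= xRich(n+k′, n−P−1)`, «at least n − P x-letters»; a block-pairing computation with E2's projections); images of
divisor classes (F2d: direct sums of node images).  Class side only.  Namespace `Summit.Ventures.HSemireg.Wedge.KernelDuality` (continued); new names only.
-/

open Module

namespace Summit.Ventures.HSemireg.Wedge.KernelDuality

open Summit.Ventures.HSemireg.Wedge Summit.Ventures.HSemireg.Wedge.Kunneth Summit.Ventures.HSemireg.Wedge.Hankel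
  Summit.Ventures.HSemireg.Wedge.HankelSiegel Summit.Ventures.HSemireg.Wedge.HankelSiegelIdeal Summit.Ventures.HSemireg.Wedge.KunnethKernel
  Summit.Ventures.HSemireg.Wedge.HankelSecant Summit.Ventures.HSemireg.Wedge.HankelFrameChange

variable (K : Type*) [Field K] {n : ℕ}

/-! ## §64. The co-Siegel forms -/

/-- **THE CO-SIEGEL FORMS of degree `j`**: `coSiegel n j := {θ ∈ Hom(univ, j) : θ ∧ s_p = 0 for every Siegel pair p}`. -/
noncomputable def coSiegel (n j : ℕ) : Submodule K (HT K (In n)) :=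
  Hom K (In n) Finset.univ j ⊓ ⨅ p : SIdx n, LinearMap.ker (LinearMap.mulRight K (sgen K p))

variable {K} in
/-- membership in the co-Siegel space. -/
lemma mem_coSiegel {j : ℕ} {θ : HT K (In n)} : θ ∈ coSiegel K n j ↔ θ ∈ Hom K (In n) Finset.univ j ∧ ∀ p : SIdx n, θ * sgen K p = 0 := by
  rw [coSiegel, Submodule.mem_inf]
  refine and_congr_right fun _ => ?_
  simp only [Submodule.mem_iInf, LinearMap.mem_ker, LinearMap.mulRight_apply]

/-- `coSiegel(j) ≤ Hom(univ, j)`. -/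
lemma coSiegel_le_Hom (j : ℕ) : coSiegel K n j ≤ Hom K (In n) Finset.univ j := inf_le_left

/-- the Siegel 2-vectors are central: `E_t ∧ s_p = s_p ∧ E_t`. -/
lemma B_mul_sgen_comm (t : Finset (In n)) (p : SIdx n) : B K (In n) t * sgen K p = sgen K p * B K (In n) t :=
  (mul_comm_of_mem_Hom_two K (show sgen K p ∈ Hom K (In n) Finset.univ 2 from sv_mem_Hom_two K _ _)
    (B_mem_Hom K (Finset.subset_univ t) rfl)).symm

/-- homogeneous classes of degree beyond `2n` vanish: `Hom(univ, a) = ⊥` for `a > 2n`. -/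
lemma Hom_univ_eq_bot_of_lt {a : ℕ} (ha : n + n < a) : Hom K (In n) Finset.univ a = ⊥ := by
  rw [Hom, Submodule.span_eq_bot]
  rintro _ ⟨s, ⟨-, hs⟩, rfl⟩
  exfalso
  have := Finset.card_le_univ s
  rw [Fintype.card_fin] at this
  omega

/-! ## §65. The annihilator of the Siegel ideal -/

/-- **`Ann_j(SI_k) = coSiegel(j)` for `k + j = 2n`**: a degree-`j` form pairs to zero with the whole degree-`k` Siegel ideal iff it is killed by every Siegel 2-vector
(⇐: `s_p` is central; ⇒: E1's non-degeneracy applied to `θ ∧ s_p` against the monomials `E_t`, `|t| = k − 2`). -/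
theorem Ann_siegelIdeal {k j : ℕ} (hkj : k + j = n + n) : Ann K j (siegelIdeal K n k) = coSiegel K n j := by
  apply le_antisymm
  · intro θ hθ
    obtain ⟨hθj, h0⟩ := mem_Ann.mp hθ
    refine mem_coSiegel.mpr ⟨hθj, fun p => ?_⟩
    have hx : θ * sgen K p ∈ Hom K (In n) Finset.univ (j + 2) := Wedge.mul_mem_Hom K hθj (sv_mem_Hom_two K _ _)
    by_cases hk : 2 ≤ k
    · refine eq_zero_of_forall_top_mul_B K (a := j + 2) (b := k - 2) (by rw [Fintype.card_fin]; omega) hx fun U hU => ?_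
      rw [mul_assoc, ← B_mul_sgen_comm]
      exact h0 _ (Submodule.subset_span ⟨(⟨U, by omega⟩, p), rfl⟩)
    · have hbot := Hom_univ_eq_bot_of_lt K (n := n) (a := j + 2) (by omega)
      rw [hbot, Submodule.mem_bot] at hx
      exact hx
  · intro θ hθ
    obtain ⟨hθj, h0⟩ := mem_coSiegel.mp hθ
    refine mem_Ann.mpr ⟨hθj, fun v hv => ?_⟩
    have key : siegelIdeal K n k ≤ LinearMap.ker (topCoeff K ∘ₗ LinearMap.mulLeft K θ) := by
      rw [siegelIdeal, Submodule.span_le]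
      rintro _ ⟨q, rfl⟩
      rw [SetLike.mem_coe, LinearMap.mem_ker, LinearMap.comp_apply, LinearMap.mulLeft_apply, igen, B_mul_sgen_comm, ← mul_assoc, h0 q.2,
        zero_mul, map_zero]
    have := key hv
    rwa [LinearMap.mem_ker, LinearMap.comp_apply, LinearMap.mulLeft_apply] at this

/-- dually **`SI_k = Ann_k(coSiegel(j))`** (`k + j = 2n`): the Siegel ideal is everything that pairs to zero with the co-Siegel forms (E1's double annihilator). -/
theorem siegelIdeal_eq_Ann_coSiegel {k j : ℕ} (hkj : k + j = n + n) : siegelIdeal K n k = Ann K k (coSiegel K n j) := by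
  rw [← Ann_siegelIdeal K hkj, Ann_Ann K (by rw [Fintype.card_fin]; omega)]
  rw [← exteriorPower_eq_Hom_univ]; exact siegelIdeal_le_exteriorPower K k

/-- **`dim coSiegel(j) = (k+1)·C(n,k)`** for `k + j = 2n` (the pairing is perfect; `dim SI_k = C(2n,k) − (k+1)·C(n,k)`). -/
theorem finrank_coSiegel {k j : ℕ} (hkj : k + j = n + n) : finrank K (coSiegel K n j) = (k + 1) * n.choose k := by
  have h1 := finrank_Ann_add K (a := j) (b := k) (by rw [Fintype.card_fin]; omega) (W := siegelIdeal K n k)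
    (by rw [← exteriorPower_eq_Hom_univ]; exact siegelIdeal_le_exteriorPower K k)
  rw [Ann_siegelIdeal K hkj, Fintype.card_fin, show (n + n).choose j = (n + n).choose k by
    rw [show j = n + n - k by omega, Nat.choose_symm (by omega)]] at h1
  have h2 := finrank_siegelIdeal K (n := n) k
  omega

/-! ## §66. The image of a generic class -/

/-- full Hankel rank in degree `k` ⇒ the kernel is the Siegel ideal (gen 11's criterion, `Kr` form: D3's containment + equal numbers). -/
theorem Kr_w_eq_siegelIdeal_of_rank {k : ℕ} {q : ℕ → K} (h : (hankel1 K n k q).rank = k + 1) : Kr K Finset.univ (w K n n q) k = siegelIdeal K n k := by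
  refine (Submodule.eq_of_le_of_finrank_eq (siegelIdeal_le_Kr_w K n k q) ?_).symm
  have h1 := finrank_Kr_w_add_rank K (n := n) k q
  have h2 := finrank_siegelIdeal K (n := n) k
  rw [h] at h1
  have : n.choose k * (k + 1) = (k + 1) * n.choose k := Nat.mul_comm _ _
  omega

/-- **THE IMAGE OF A GENERIC CLASS IS THE CO-SIEGEL SPACE: `rank H_k(q) = k + 1`, `k + k′ = n` ⇒ `V(univ, w_n(q), k′) = coSiegel(k′ + n)`** — every class of full Hankel
rank in degree `k` has the SAME image on `⋀^{k′}`: the forms of degree `n + k′` killed by every Siegel 2-vector. -/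
theorem V_w_eq_coSiegel_of_rank {k k' : ℕ} (hkk' : k + k' = n) {q : ℕ → K} (h : (hankel1 K n k q).rank = k + 1) :
    V K (In n) Finset.univ (w K n n q) k' = coSiegel K n (k' + n) := by
  rw [V_w_eq_Ann K hkk', Kr_w_eq_siegelIdeal_of_rank K h, Ann_siegelIdeal K (by omega)]

/-- so **two classes of full Hankel rank in degree `k` have the same image on `⋀^{k′}`** (`k + k′ = n`). -/
theorem V_w_eq_V_w_of_rank {k k' : ℕ} (hkk' : k + k' = n) {q q' : ℕ → K} (h : (hankel1 K n k q).rank = k + 1) (h' : (hankel1 K n k q').rank = k + 1) :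
    V K (In n) Finset.univ (w K n n q) k' = V K (In n) Finset.univ (w K n n q') k' := by
  rw [V_w_eq_coSiegel_of_rank K hkk' h, V_w_eq_coSiegel_of_rank K hkk' h']

/-- `dim V(univ, w_n(q), k′) = (k+1)·C(n,k)` for a class of full rank in degree `k` (`k + k′ = n`) — THEOREM H's `C(n,k′)·rank H_{k′}` from the other side. -/
theorem finrank_V_w_of_rank {k k' : ℕ} (hkk' : k + k' = n) {q : ℕ → K} (h : (hankel1 K n k q).rank = k + 1) :
    finrank K (V K (In n) Finset.univ (w K n n q) k') = (k + 1) * n.choose k := by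
  rw [V_w_eq_coSiegel_of_rank K hkk' h, finrank_coSiegel K (k := k) (j := k' + n) (by omega)]

/-! ## §67. The image of a node -/

/-- **THE IMAGE OF A NODE AT `0`: `V(univ, w_n(q), k′) = coSiegel(k′ + n) ⊓ Ann_{k′+n}(xRich(k, P))`** for `q` supported on `[0, P]` with `q_P ≠ 0`, `P ≤ k′`, `k + k′ = n` —
the co-Siegel forms that pair to zero with every degree-`k` form having more than `P` x-letters (E1's `V_w_eq_Ann` on E3's kernel law). -/
theorem V_w_of_order {k k' P : ℕ} (hkk' : k + k' = n) (hP : P ≤ k') {q : ℕ → K} (hq : ∀ j, P < j → q j = 0) (hqP : q P ≠ 0) :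
    V K (In n) Finset.univ (w K n n q) k' = coSiegel K n (k' + n) ⊓ Ann K (k' + n) (xRich K n k P) := by
  rw [V_w_eq_Ann K hkk', Kr_w_eq_of_order K (by omega) hq hqP, Ann_sup, Ann_siegelIdeal K (by omega)]

/-- it depends only on the order `P` (and the degree): two classes of the same exact order at `0` have the same images. -/
theorem V_w_eq_V_w_of_order {k k' P : ℕ} (hkk' : k + k' = n) (hP : P ≤ k') {q q' : ℕ → K} (hq : ∀ j, P < j → q j = 0) (hqP : q P ≠ 0)
    (hq' : ∀ j, P < j → q' j = 0) (hqP' : q' P ≠ 0) :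
    V K (In n) Finset.univ (w K n n q) k' = V K (In n) Finset.univ (w K n n q') k' := by
  rw [V_w_of_order K hkk' hP hq hqP, V_w_of_order K hkk' hP hq' hqP']

/-- **THE IMAGE OF A NODE AT `λ`**: `V(univ, w_n(expMul λ q), k′) = Φs λ (coSiegel(k′ + n) ⊓ Ann_{k′+n}(xRich(k, P)))` (E5's transport of the node at `0`). -/
theorem V_w_expMul_of_order (lam : K) {k k' P : ℕ} (hkk' : k + k' = n) (hP : P ≤ k') {q : ℕ → K} (hq : ∀ j, P < j → q j = 0) (hqP : q P ≠ 0) :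
    V K (In n) Finset.univ (w K n n (expMul K lam q)) k' =
      (coSiegel K n (k' + n) ⊓ Ann K (k' + n) (xRich K n k P)).map (Φs K (n := n) lam).toLinearMap := by
  rw [V_w_expMul, V_w_of_order K hkk' hP hq hqP]

/-- **THE CO-SIEGEL SPACE IS FRAME-INVARIANT: `Φs λ (coSiegel(j)) = coSiegel(j)`** for every `j` (E5: `Φs λ` fixes every Siegel 2-vector and preserves degrees). -/
theorem map_Φs_coSiegel (lam : K) (j : ℕ) : (coSiegel K n j).map (Φs K (n := n) lam).toLinearMap = coSiegel K n j := by
  have hle : (coSiegel K n j).map (Φs K (n := n) lam).toLinearMap ≤ coSiegel K n j := by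
    rintro _ ⟨θ, hθ, rfl⟩
    obtain ⟨hθj, h0⟩ := mem_coSiegel.mp hθ
    refine mem_coSiegel.mpr ⟨?_, fun p => ?_⟩
    · rw [Hom_univ_eq_exteriorPower] at hθj ⊢
      exact Φs_mem_exteriorPower K lam hθj
    · rw [AlgEquiv.toLinearMap_apply, ← Φs_sgen K lam p, ← map_mul, h0 p, map_zero]
  exact Submodule.eq_of_le_of_finrank_eq hle ((Φs K (n := n) lam).toLinearEquiv.finrank_map_eq _)

/-- hence the image of a node at `λ` in co-Siegel form: `V(univ, w_n(expMul λ q), k′) = coSiegel(k′ + n) ⊓ Φs λ (Ann_{k′+n}(xRich(k, P)))`. -/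
theorem V_w_expMul_of_order' (lam : K) {k k' P : ℕ} (hkk' : k + k' = n) (hP : P ≤ k') {q : ℕ → K} (hq : ∀ j, P < j → q j = 0) (hqP : q P ≠ 0) :
    V K (In n) Finset.univ (w K n n (expMul K lam q)) k' =
      coSiegel K n (k' + n) ⊓ (Ann K (k' + n) (xRich K n k P)).map (Φs K (n := n) lam).toLinearMap := by
  rw [V_w_expMul_of_order K lam hkk' hP hq hqP, Submodule.map_inf _ (Φs K (n := n) lam).injective, map_Φs_coSiegel]

end Summit.Ventures.HSemireg.Wedge.KernelDuality
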